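import Summits.Ventures.PercRepro.ProfilePointedCaptured

/-!
# PercRepro — (A1κ) AT THE TWO EXTREME INSTANCES: COLOOPS (unconditional) AND PARALLEL PAIRS (Theorem A for a minor)
(p10, gen 15; `proofs/P10-AVFULL.md` §23(a))

The captured profile `κ_k = #{X ∈ BI_k : p ∉ X, p ∈ cl X}` vanishes at a COLOOP `p` (no `p`-avoiding set spans `p`):
`capCount_coloop`, so (A1κ) `(N − k − 1) κ_k ≤ k κ_{k+1}` holds there with no hypothesis (`pointedRowCap_coloop`).  At a
PARALLEL PAIR `{p, e}` the compensation vanishes (`c^p_k = 0`, gen 13's `extCount_parallel`), so `κ_k = out_k`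
(`capCount_parallel`) and (A1κ) is exactly (A1) there — Theorem A at level `k − 1` for the minor `(M ∖ p) / e` on `N − 2`
elements, modulo the named fact (`pointedRowCap_parallel_of_fact`, from gen 14's `pointedRowOut_parallel_of_fact`).
These are the tight instances of (A1κ) on the census.  Nothing here asserts (A1κ) in general.
-/

open scoped Matroid

namespace PercRepro.Cogirth

open Finset ThmH Skew

variable {α : Type} [DecidableEq α] {M : Matroid α} [M.Finite]

/-- At a coloop every `p`-avoiding bi-independent set extends by `p`: `out_k = c^p_k`. -/
theorem outCount_eq_extCount_coloop {p : α} (hp : p ∈ gr M) (hpc : rk M ((gr M).erase p) + 1 = rk M (gr M))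
    (k : ℕ) : outCount M k p = extCount M k p := by
  unfold outCount
  rw [filter_biIndepSets_notMem_coloop hp hpc k, extCount_coloop hp hpc k]

/-- **`κ = 0` AT A COLOOP**: no `p`-avoiding set captures a coloop `p`. -/
theorem capCount_coloop {p : α} (hp : p ∈ gr M) (hpc : rk M ((gr M).erase p) + 1 = rk M (gr M)) (k : ℕ) :
    capCount M k p = 0 := by
  have h := capCount_add_extCount k hp
  rw [outCount_eq_extCount_coloop hp hpc k] at h
  omega

/-- **(A1κ) AT EVERY COLOOP** (unconditional): both sides vanish. -/
theorem pointedRowCap_coloop (M : Matroid α) [M.Finite] {p : α} (hp : p ∈ gr M)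
    (hpc : rk M ((gr M).erase p) + 1 = rk M (gr M)) (k : ℕ) :
    ((gr M).card - k - 1) * capCount M k p ≤ k * capCount M (k + 1) p := by
  rw [capCount_coloop hp hpc k, capCount_coloop hp hpc (k + 1)]
  simp only [Nat.mul_zero, le_refl]

/-- At a parallel pair `{p, e}` the compensation vanishes, so every `p`-avoiding bi-independent set captures `p`:
`κ_k = out_k`. -/
theorem capCount_parallel {p e : α} (hp : p ∈ gr M) (he : e ∈ gr M) (hpe' : p ≠ e) (hpe : rk M {p, e} = 1)
    (k : ℕ) : capCount M k p = outCount M k p := by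
  have h := capCount_add_extCount k hp
  rw [extCount_parallel hp he hpe' hpe k] at h
  omega

/-- **(A1κ) AT EVERY PARALLEL PAIR** (conditional on the named fact): it is (A1) there, i.e. Theorem A at level
`k − 1` for the minor `(M ∖ p) / e` (gen 14, `pointedRowOut_parallel_of_fact`). -/
theorem pointedRowCap_parallel_of_fact (hfact : BiIndepDensityLogConcave α) (M : Matroid α) [M.Finite]
    {p e : α} (hp : p ∈ gr M) (he : e ∈ gr M) (hpe' : p ≠ e) (hp1 : rk M {p} = 1) (he1 : rk M {e} = 1)
    (hpe : rk M {p, e} = 1) (k : ℕ) (hk : 2 * k + 2 ≤ (gr M).card) :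
    ((gr M).card - k - 1) * capCount M k p ≤ k * capCount M (k + 1) p := by
  have h := pointedRowOut_parallel_of_fact hfact M hp he hpe' hp1 he1 hpe k hk
  rw [extCount_parallel hp he hpe' hpe k, Nat.mul_zero, Nat.add_zero] at h
  rw [capCount_parallel hp he hpe' hpe k, capCount_parallel hp he hpe' hpe (k + 1)]
  exact h

end PercRepro.Cogirth
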